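import Summits.NavierStokesRegularity.NavierStokesRegularity.Theorems.StretchingWellBindingEnstrophyQuarterLawSparsenessTools
import HarnessLib

/-!
# `TypeIQuarterGate.QuarterLawTypeI` (crux stmt-23726), line `lorentz-upgrade`, stub `stub_lorentzCount`
# (= `LorentzCountTypeI`, stmt-24109) — the WEAK-`L³` COUNTING LEMMA (dyadic layer cake + bounded overlap)

Helper file (`--supports stmt-NavierStokesRegularity-23726`). Pure measure theory on `ℝ³`: if a continuous
field `f` with `|f| ≤ U` has weak-`L³` quasi-norm `sup_λ λ³ |{|f| > λ}| ≤ M'`, then a `2r`-separated family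
of centres whose `ρ`-balls each carry `∫_{B(x,ρ)} |f|³ > γ³` has at most
`16 (K+1) ((ρ + r)/r)³ M'/γ³` members, where `λ₀` is any level with `λ₀³ |B_ρ| ≤ γ³/2` and
`U ≤ 2^{K+1} λ₀` (dyadic levels `λ_k = 2^k λ₀`: pointwise `|f|³ ≤ λ₀³ + Σ_{k ≤ K} 8 λ_k³ 1_{|f| > λ_k}`,
integrate over the balls, bounded overlap `EnstrophyQuarterLaw.Sparseness…sum_setLIntegral_ball_le_of_separated`,
and `λ_k³ |{|f| > λ_k}| ≤ M'` level by level). This is the additivity mechanism named by the route text for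
`LorentzCountTypeI` ("additivity of `λ³|{|u|>λ} ∩ B_i|` over the disjoint balls against `λ³|{|u|>λ}| ≤ M′`").
HONEST FRAMING: folklore real analysis; nothing about Navier–Stokes is claimed. [folklore]
-/

noncomputable section

-- the summit-side namespace repeats a component by design (D-0017)
set_option linter.dupNamespace false

namespace Summit.NavierStokesRegularity.NavierStokesRegularity.Theorems.CountQuarterLaw

open Set MeasureTheory Function Metric Filter Topology
open scoped ENNReal NNReal

/-- **Dyadic layer cake, pointwise.** For `0 < λ₀`, `0 ≤ a ≤ 2^{K+1} λ₀`:
`a³ ≤ λ₀³ + Σ_{k=0}^{K} 8 (2^k λ₀)³ · [2^k λ₀ < a]`. [folklore] -/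
theorem pow_three_le_dyadic (l0 : ℝ) (hl0 : 0 < l0) :
    ∀ (K : ℕ) (a : ℝ), 0 ≤ a → a ≤ 2 ^ (K + 1) * l0 →
      a ^ 3 ≤ l0 ^ 3 + ∑ k ∈ Finset.range (K + 1),
        (if 2 ^ k * l0 < a then 8 * (2 ^ k * l0) ^ 3 else 0) := by
  intro K
  induction K with
  | zero =>
    intro a ha0 haU
    simp only [zero_add, pow_one, Finset.range_one, Finset.sum_singleton, pow_zero, one_mul] at haU ⊢
    by_cases h : l0 < a
    · rw [if_pos h]
      have : a ^ 3 ≤ (2 * l0) ^ 3 := pow_le_pow_left₀ ha0 haU 3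
      nlinarith [pow_pos hl0 3]
    · rw [if_neg h]
      have : a ^ 3 ≤ l0 ^ 3 := pow_le_pow_left₀ ha0 (not_lt.1 h) 3
      linarith
  | succ K ih =>
    intro a ha0 haU
    have hterms : ∀ k ∈ Finset.range (K + 1 + 1),
        (0 : ℝ) ≤ (if 2 ^ k * l0 < a then 8 * (2 ^ k * l0) ^ 3 else 0) := by
      intro k _
      split_ifs
      · positivity
      · exact le_rfl
    rw [Finset.sum_range_succ]
    by_cases h : 2 ^ (K + 1) * l0 < a
    · rw [if_pos h]
      have h1 : a ^ 3 ≤ (2 ^ (K + 1 + 1) * l0) ^ 3 := pow_le_pow_left₀ ha0 haU 3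
      have h2 : (2 : ℝ) ^ (K + 1 + 1) * l0 = 2 * (2 ^ (K + 1) * l0) := by ring
      rw [h2] at h1
      have h3 : (0 : ℝ) ≤ ∑ k ∈ Finset.range (K + 1),
          (if 2 ^ k * l0 < a then 8 * (2 ^ k * l0) ^ 3 else 0) :=
        Finset.sum_nonneg fun k hk => hterms k (Finset.mem_range.2
          ((Finset.mem_range.1 hk).trans (Nat.lt_succ_self _)))
      nlinarith [pow_pos hl0 3]
    · rw [if_neg h]
      have := ih a ha0 (not_lt.1 h)
      linarith

/-- **Weak-`L³` counting by dyadic levels and bounded overlap.** Let `f : ℝ³ → ℝ³` be continuous with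
`‖f‖ ≤ U`, and weak-`L³`-bounded: `t³ · |{t < ‖f‖}| ≤ M'` for every level `t ≥ 0`. Let `σ` be a finite
family of centres, pairwise at distance `≥ 2r` (`r > 0`), whose `ρ`-balls concentrate:
`γ³ < ∫_{B(x,ρ)} ‖f‖³` for `x ∈ σ`. If `λ₀ > 0` satisfies `λ₀³ · ρ³ |B₁| ≤ γ³/2` and `U ≤ 2^{K+1} λ₀`, then
`#σ · γ³/2 ≤ 8 (K+1) ((ρ + r)/r)³ M'`. [folklore] -/
theorem card_mul_le_of_weakL3_concentration
    {f : EuclideanSpace ℝ (Fin 3) → EuclideanSpace ℝ (Fin 3)} (hf : Continuous f)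
    {U M' γ r ρ l0 : ℝ} {K : ℕ} (hM' : 0 ≤ M') (hγ : 0 < γ) (hr : 0 < r) (hρ : 0 < ρ)
    (hl0 : 0 < l0)
    (hbound : ∀ y, ‖f y‖ ≤ U)
    (hweak : ∀ t : ℝ≥0, (t : ℝ≥0∞) ^ (3 : ℝ) * volume {y | (t : ℝ≥0∞) < ‖f y‖ₑ} ≤ ENNReal.ofReal M')
    (hl0γ : l0 ^ 3 * (ρ ^ 3 * (volume (ball (0 : EuclideanSpace ℝ (Fin 3)) 1)).toReal) ≤ γ ^ 3 / 2)
    (hK : U ≤ 2 ^ (K + 1) * l0)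
    (σ : Finset (EuclideanSpace ℝ (Fin 3)))
    (hsep : ∀ x ∈ σ, ∀ x' ∈ σ, x ≠ x' → 2 * r ≤ dist x x')
    (hconc : ∀ x ∈ σ, ENNReal.ofReal (γ ^ 3) < ∫⁻ y in ball x ρ, ‖f y‖ₑ ^ (3 : ℕ)) :
    (σ.card : ℝ) * (γ ^ 3 / 2) ≤ 8 * (K + 1) * ((ρ + r) / r) ^ 3 * M' := by
  classical
  -- the dyadic level sets and their weights
  set A : ℕ → Set (EuclideanSpace ℝ (Fin 3)) := fun k => {y | (2 : ℝ) ^ k * l0 < ‖f y‖} with hA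
  have hAopen : ∀ k, IsOpen (A k) := fun k => isOpen_lt continuous_const hf.norm
  have hAmeas : ∀ k, MeasurableSet (A k) := fun k => (hAopen k).measurableSet
  set c : ℕ → ℝ≥0∞ := fun k => ENNReal.ofReal (8 * (2 ^ k * l0) ^ 3) with hc
  set g : ℕ → EuclideanSpace ℝ (Fin 3) → ℝ≥0∞ := fun k => (A k).indicator fun _ => c k with hg
  have hgmeas : ∀ k, Measurable (g k) := fun k => measurable_const.indicator (hAmeas k)
  -- pointwise dyadic layer cake in `ℝ≥0∞`
  have hpt : ∀ y, ‖f y‖ₑ ^ (3 : ℕ) ≤ ENNReal.ofReal (l0 ^ 3) + ∑ k ∈ Finset.range (K + 1), g k y := by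
    intro y
    have hreal := pow_three_le_dyadic l0 hl0 K ‖f y‖ (norm_nonneg _) ((hbound y).trans hK)
    have hsum : ∑ k ∈ Finset.range (K + 1), g k y = ENNReal.ofReal (∑ k ∈ Finset.range (K + 1),
        (if 2 ^ k * l0 < ‖f y‖ then 8 * (2 ^ k * l0) ^ 3 else 0)) := by
      rw [ENNReal.ofReal_sum_of_nonneg (fun k _ => by split_ifs <;> positivity)]
      refine Finset.sum_congr rfl fun k _ => ?_
      simp only [hg, hc, Set.indicator_apply, hA, mem_setOf_eq]
      split_ifs <;> simp
    rw [hsum, ← ENNReal.ofReal_add (by positivity) (Finset.sum_nonneg fun k _ => by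
      split_ifs <;> positivity), ← ofReal_norm, ← ENNReal.ofReal_pow (norm_nonneg _)]
    exact ENNReal.ofReal_le_ofReal hreal
  -- integrate over one ball
  have hvolB : ∀ x : EuclideanSpace ℝ (Fin 3), volume (ball x ρ) =
      ENNReal.ofReal (ρ ^ 3 * (volume (ball (0 : EuclideanSpace ℝ (Fin 3)) 1)).toReal) := by
    intro x
    rw [Measure.addHaar_ball volume x hρ.le, finrank_euclideanSpace_fin,
      ENNReal.ofReal_mul (pow_nonneg hρ.le 3), ENNReal.ofReal_toReal measure_ball_lt_top.ne]
  have hball : ∀ x : EuclideanSpace ℝ (Fin 3), ∫⁻ y in ball x ρ, ‖f y‖ₑ ^ (3 : ℕ) ≤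
      ENNReal.ofReal (γ ^ 3 / 2) + ∑ k ∈ Finset.range (K + 1), ∫⁻ y in ball x ρ, g k y := by
    intro x
    calc ∫⁻ y in ball x ρ, ‖f y‖ₑ ^ (3 : ℕ)
        ≤ ∫⁻ y in ball x ρ, (ENNReal.ofReal (l0 ^ 3) + ∑ k ∈ Finset.range (K + 1), g k y) :=
          lintegral_mono fun y => hpt y
      _ = ENNReal.ofReal (l0 ^ 3) * volume (ball x ρ) +
            ∑ k ∈ Finset.range (K + 1), ∫⁻ y in ball x ρ, g k y := by
          rw [lintegral_add_left measurable_const, setLIntegral_const,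
            lintegral_finsetSum _ fun k _ => hgmeas k]
      _ ≤ ENNReal.ofReal (γ ^ 3 / 2) + ∑ k ∈ Finset.range (K + 1), ∫⁻ y in ball x ρ, g k y := by
          refine add_le_add ?_ le_rfl
          rw [hvolB x, ← ENNReal.ofReal_mul (by positivity)]
          exact ENNReal.ofReal_le_ofReal hl0γ
  -- sum over the family; bounded overlap level by level; weak-L³ bound level by level
  set O : ℝ := ((ρ + 2 * r / 2) / (2 * r / 2)) ^ 3 with hO
  have hO' : O = ((ρ + r) / r) ^ 3 := by rw [hO]; congr 1; field_simp
  have hover : ∀ k, ∑ x ∈ σ, ∫⁻ y in ball x ρ, g k y ≤ ENNReal.ofReal O * (c k * volume (A k)) := by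
    intro k
    have h := EnstrophyQuarterLaw.SparsenessTools.sum_setLIntegral_ball_le_of_separated (s := 2 * r)
      (by positivity) hρ σ hsep (hgmeas k).aemeasurable
    refine h.trans (le_of_eq ?_)
    rw [hg, lintegral_indicator_const (hAmeas k)]
  have hlevel : ∀ k, c k * volume (A k) ≤ 8 * ENNReal.ofReal M' := by
    intro k
    have ht0 : (0 : ℝ) ≤ 2 ^ k * l0 := by positivity
    have hw := hweak (Real.toNNReal (2 ^ k * l0))
    rw [show ((Real.toNNReal (2 ^ k * l0) : ℝ≥0) : ℝ≥0∞) = ENNReal.ofReal (2 ^ k * l0) from rfl] at hw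
    have hset : {y | ENNReal.ofReal (2 ^ k * l0) < ‖f y‖ₑ} = A k := by
      ext y
      simp only [mem_setOf_eq, hA]
      rw [← ofReal_norm, ENNReal.ofReal_lt_ofReal_iff_of_nonneg ht0]
    rw [hset] at hw
    have hcoe : (ENNReal.ofReal (2 ^ k * l0)) ^ (3 : ℝ) = ENNReal.ofReal ((2 ^ k * l0) ^ 3) := by
      rw [ENNReal.ofReal_rpow_of_nonneg ht0 (by norm_num)]
      congr 1
      exact_mod_cast Real.rpow_natCast (2 ^ k * l0) 3
    rw [hcoe] at hw
    calc c k * volume (A k) = 8 * (ENNReal.ofReal ((2 ^ k * l0) ^ 3) * volume (A k)) := by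
          rw [hc]
          simp only
          rw [ENNReal.ofReal_mul (by norm_num), ENNReal.ofReal_ofNat, mul_assoc]
      _ ≤ 8 * ENNReal.ofReal M' := mul_le_mul' le_rfl hw
  -- the chain
  have hchain : (σ.card : ℝ≥0∞) * ENNReal.ofReal (γ ^ 3) ≤
      (σ.card : ℝ≥0∞) * ENNReal.ofReal (γ ^ 3 / 2) +
        (K + 1 : ℕ) * (ENNReal.ofReal O * (8 * ENNReal.ofReal M')) := by
    calc (σ.card : ℝ≥0∞) * ENNReal.ofReal (γ ^ 3)
        = ∑ x ∈ σ, ENNReal.ofReal (γ ^ 3) := by rw [Finset.sum_const, nsmul_eq_mul]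
      _ ≤ ∑ x ∈ σ, ∫⁻ y in ball x ρ, ‖f y‖ₑ ^ (3 : ℕ) := Finset.sum_le_sum fun x hx => (hconc x hx).le
      _ ≤ ∑ x ∈ σ, (ENNReal.ofReal (γ ^ 3 / 2) + ∑ k ∈ Finset.range (K + 1), ∫⁻ y in ball x ρ, g k y) :=
          Finset.sum_le_sum fun x _ => hball x
      _ = (σ.card : ℝ≥0∞) * ENNReal.ofReal (γ ^ 3 / 2) +
            ∑ k ∈ Finset.range (K + 1), ∑ x ∈ σ, ∫⁻ y in ball x ρ, g k y := by
          rw [Finset.sum_add_distrib, Finset.sum_const, nsmul_eq_mul, Finset.sum_comm]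
      _ ≤ (σ.card : ℝ≥0∞) * ENNReal.ofReal (γ ^ 3 / 2) +
            ∑ k ∈ Finset.range (K + 1), ENNReal.ofReal O * (8 * ENNReal.ofReal M') := by
          refine add_le_add le_rfl (Finset.sum_le_sum fun k _ => ?_)
          exact (hover k).trans (mul_le_mul' le_rfl (hlevel k))
      _ = _ := by rw [Finset.sum_const, Finset.card_range, nsmul_eq_mul]
  -- pass to `ℝ`
  have hO0 : 0 ≤ O := by rw [hO]; positivity
  have e1 : (σ.card : ℝ≥0∞) * ENNReal.ofReal (γ ^ 3) = ENNReal.ofReal (σ.card * γ ^ 3) := by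
    rw [ENNReal.ofReal_mul (Nat.cast_nonneg _), ENNReal.ofReal_natCast]
  have e2 : (σ.card : ℝ≥0∞) * ENNReal.ofReal (γ ^ 3 / 2) +
      (K + 1 : ℕ) * (ENNReal.ofReal O * (8 * ENNReal.ofReal M')) =
      ENNReal.ofReal (σ.card * (γ ^ 3 / 2) + (K + 1 : ℕ) * (O * (8 * M'))) := by
    rw [ENNReal.ofReal_add (by positivity) (by positivity), ENNReal.ofReal_mul (Nat.cast_nonneg _),
      ENNReal.ofReal_natCast, ENNReal.ofReal_mul (Nat.cast_nonneg _), ENNReal.ofReal_natCast,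
      ENNReal.ofReal_mul hO0, ENNReal.ofReal_mul (by norm_num), ENNReal.ofReal_ofNat]
  rw [e1, e2, ENNReal.ofReal_le_ofReal_iff (by positivity)] at hchain
  rw [← hO']
  push_cast at hchain
  nlinarith [hchain, hO0, hM']

end Summit.NavierStokesRegularity.NavierStokesRegularity.Theorems.CountQuarterLaw

end
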